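import Mathlib
import Summits.QuantumFields.YangMills.Theses.SpecificationCompactness
import Summits.QuantumFields.YangMills.Theorems.SpecificationCompactnessCondExpDensityCalculus
import Literature.MathematicalPhysics.QuantumFieldTheory.Balaban1983to89.T3HeightwiseDensityBounds

/-!
# Height-zero density bridge: `∫ρ̂_K dπ₀ = Z_K`, the two density currencies agree at height zero, and `UnitDensityUI` ⇐ the height-zero
# clause of the tree's heightwise `K`-uniform upper stability bound (route SpecificationCompactness, crux r3, stmt-QuantumFields-28251;
# the planner's skeleton «heightwise»: C2 = the `n = 0` clause of `T3HeightwiseDensityBounds.HeightwiseUpperBound`)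

THE TWO DENSITY CURRENCIES AGREE AT HEIGHT ZERO: the tree carries the renormalised unit density twice — `T3UnitLawDensityEML.unitDensity F γ K`
(`unitLaw_K = Z_K⁻¹ρ̂_K·π₀`, `unitLaw_eq_withDensity_emlDensity`) and `T3TiltDescent.heightDensity F γ (0 ≤ K) univ` (the density of the
descended run law `(D_{0,K})_*Gibbs_K = Z_K⁻¹ρ_{K}·π₀`, `map_descendTo_restrict_eq_withDensity`).  Since `D_{0,K}` IS the unit transport `A_K`
(`unitA_descendTo` at `n = 0`), the two laws coincide and the densities agree `π₀`-a.e. (`withDensity_eq_iff`).  Consequently the `n = 0` clause of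
`HeightwiseUpperBound F γ` — a `K`-UNIFORM `L^∞` bound `Z_K⁻¹ρ̂_K ≤ C` a.e. ([Balaban1985UV3] Thm 1 (5) at `k = K` over (6), quotient reading) — gives
the uniform integrability clause of `UnitDensityUI` at `(F, γ)` trivially (`(ũ_K − M)₊ = 0` a.e. for `M ≥ C`; `(∫ρ̂_K)⁻¹ = Z_K⁻¹`), and the
schema with a coupling threshold gives the crux `UnitDensityUI` BY NAME (`unitDensityUI_of_heightwiseUpperBound`).

HONEST FRAMING.  A door from a HYPOTHESIS SCHEMA (`HeightwiseUpperBound` is typed, not asserted — it is the construction statement of the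
Bałaban lane for the pinned `ℰp` densities) to the crux; rung R3 RECORD line; nothing about `ContinuumYM3Torus` or the YM mass gap is proved.
-/

noncomputable section

namespace Summit.QuantumFields.YangMills.Theorems.SpecificationCompactnessKernel

open MeasureTheory Filter Topology
open Literature.MathematicalPhysics.QuantumFieldTheory.Balaban1983to89
open Literature.MathematicalPhysics.QuantumFieldTheory.Balaban1983to89.T3ContinuumYM3Torus
open Literature.MathematicalPhysics.QuantumFieldTheory.Balaban1983to89.T3LevelShift
open Literature.MathematicalPhysics.QuantumFieldTheory.Balaban1983to89.Missing
open Literature.MathematicalPhysics.QuantumFieldTheory.Balaban1983to89.T4Continuum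
open Literature.MathematicalPhysics.QuantumFieldTheory.Balaban1983to89.T3ThresholdRemoval
open Literature.MathematicalPhysics.QuantumFieldTheory.Balaban1983to89.T3UnitLawDensityEML
open Literature.MathematicalPhysics.QuantumFieldTheory.Balaban1983to89.T3UnitScaleTilt
open Literature.MathematicalPhysics.QuantumFieldTheory.Balaban1983to89.T3TiltDescent
open Literature.MathematicalPhysics.QuantumFieldTheory.Balaban1983to89.T3HeightwiseDensityBounds

/-- `∫ ρ̂_K dπ₀ = Z_K` (the renormalised unit density integrates to the partition function: the unit law `Z⁻¹ρ̂_K·π₀` is a probability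
measure). [cite: Balaban1985UV3, (2) p.256 + (6) p.257] -/
theorem integral_unitDensity (F : T3Family) {γ : ℝ} (hγ : 0 ≤ γ) (K : ℕ) :
    ∫ W, unitDensity F γ K W ∂fieldMeasure (F.P 0) 0 (Matrix.specialUnitaryGroup (Fin 2) ℂ) =
      partitionFn (G := Matrix.specialUnitaryGroup (Fin 2) ℂ) (F.P K) ((F.scheme ℰp γ).β K) := by
  obtain ⟨hdm, hd0, hdi⟩ := unitDensity_props F K hγ
  have hZ : 0 < partitionFn (G := Matrix.specialUnitaryGroup (Fin 2) ℂ) (F.P K) ((F.scheme ℰp γ).β K) :=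
    partitionFn_pos' _ (F.scheme_β_nonneg ℰp hγ K)
  set Z := partitionFn (G := Matrix.specialUnitaryGroup (Fin 2) ℂ) (F.P K) ((F.scheme ℰp γ).β K) with hZdef
  haveI := isProbabilityMeasure_unitLaw (F := F) (ℰ := ℰp) measurableE_ℰp hγ K
  have h1 : ∫ _u, (1 : ℝ) ∂F.unitLaw ℰp measurableE_ℰp γ K = 1 := by simp
  rw [unitLaw_eq_withDensity_emlDensity F K hγ] at h1
  have h2 := integral_lawOf (π := fieldMeasure (F.P 0) 0 (Matrix.specialUnitaryGroup (Fin 2) ℂ))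
    (u := fun u => Z⁻¹ * unitDensity F γ K u) (hdm.const_mul _)
    (fun u => mul_nonneg (inv_nonneg.mpr hZ.le) (hd0 u)) (fun _ => (1 : ℝ))
  rw [h2] at h1
  simp only [mul_one, integral_const_mul] at h1
  field_simp at h1
  linarith

variable (F : T3Family) {γ : ℝ}

/-- `D_{0,K} = A_K`: descending the `K`-th approximation to height zero IS the unit transport. [cite: Balaban1987RG1, (0.11) p.253] -/
theorem descendTo_zero_eq_unitA (K : ℕ) (U : GaugeField (F.P K) 0 (Matrix.specialUnitaryGroup (Fin 2) ℂ)) :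
    descendTo F ℰp 0 K (Nat.zero_le K) U = unitA F ℰp K U := by
  rw [← unitA_descendTo F ℰp (Nat.zero_le K) U]
  show _ = fieldShift (F.sitesPerDir_unit 0)
    (Averaging.iter (fun i => BlockAveraging.blockAvg (P := F.P 0) (j := i) ℰp) 0 (descendTo F ℰp 0 K (Nat.zero_le K) U))
  exact (fieldShift_refl _ _).symm

/-- **THE TWO DENSITY CURRENCIES AGREE AT HEIGHT ZERO**: `Z_K⁻¹·heightDensity F γ (0 ≤ K) univ = Z_K⁻¹·unitDensity F γ K` for `π₀`-a.e. unit
configuration (`γ ≥ 0`). [cite: Balaban1985UV3, (2) p.256 + (6) p.257] -/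
theorem heightDensity_zero_ae_eq_unitDensity (hγ : 0 ≤ γ) (K : ℕ) :
    (fun V => (partitionFn (G := Matrix.specialUnitaryGroup (Fin 2) ℂ) (F.P K) ((F.scheme ℰp γ).β K))⁻¹ *
        heightDensity F γ (Nat.zero_le K) Set.univ V) =ᵐ[fieldMeasure (F.P 0) 0 (Matrix.specialUnitaryGroup (Fin 2) ℂ)]
      fun V => (partitionFn (G := Matrix.specialUnitaryGroup (Fin 2) ℂ) (F.P K) ((F.scheme ℰp γ).β K))⁻¹ * unitDensity F γ K V := by
  set Z := partitionFn (G := Matrix.specialUnitaryGroup (Fin 2) ℂ) (F.P K) ((F.scheme ℰp γ).β K) with hZdef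
  have hZ : 0 < Z := partitionFn_pos' _ (F.scheme_β_nonneg ℰp hγ K)
  obtain ⟨hhm, hhi⟩ := heightDensity_props F (Nat.zero_le K) (S := Set.univ) MeasurableSet.univ hγ
  obtain ⟨hum, hu0, hui⟩ := unitDensity_props F K hγ
  -- the two `withDensity` presentations of the unit law
  have h1 : F.unitLaw ℰp measurableE_ℰp γ K =
      (fieldMeasure (F.P 0) 0 (Matrix.specialUnitaryGroup (Fin 2) ℂ)).withDensity
        (fun V => ENNReal.ofReal (Z⁻¹ * heightDensity F γ (Nat.zero_le K) Set.univ V)) := by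
    have h := map_descendTo_restrict_eq_withDensity F (Nat.zero_le K) (S := Set.univ) MeasurableSet.univ hγ
    rw [Measure.restrict_univ] at h
    have hD : descendTo F ℰp 0 K (Nat.zero_le K) = unitA F ℰp K := funext (descendTo_zero_eq_unitA F K)
    rw [hD] at h
    rw [unitLaw_eq_map_unitA]
    exact h
  have h2 := unitLaw_eq_withDensity_emlDensity F K hγ
  rw [h1] at h2
  -- `withDensity` is injective on a.e.-classes of finite densities
  have h0 : ∀ V, 0 ≤ Z⁻¹ * heightDensity F γ (Nat.zero_le K) Set.univ V := fun V =>
    mul_nonneg (inv_nonneg.mpr hZ.le) (heightDensity_nonneg F γ (Nat.zero_le K) Set.univ V)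
  have hfin : ∫⁻ V, ENNReal.ofReal (Z⁻¹ * heightDensity F γ (Nat.zero_le K) Set.univ V)
      ∂fieldMeasure (F.P 0) 0 (Matrix.specialUnitaryGroup (Fin 2) ℂ) ≠ ⊤ :=
    ((hasFiniteIntegral_iff_ofReal (Eventually.of_forall h0)).mp (hhi.const_mul Z⁻¹).2).ne
  have hae := (withDensity_eq_iff ((hhm.const_mul _).ennreal_ofReal.aemeasurable)
    ((hum.const_mul _).ennreal_ofReal.aemeasurable) hfin).mp h2
  filter_upwards [hae] with V hV
  have h0l : 0 ≤ Z⁻¹ * heightDensity F γ (Nat.zero_le K) Set.univ V := h0 V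
  have h0r : 0 ≤ Z⁻¹ * unitDensity F γ K V := mul_nonneg (inv_nonneg.mpr hZ.le) (hu0 V)
  exact (ENNReal.ofReal_eq_ofReal_iff h0l h0r).mp hV

/-- **DOMINATION OF THE UNIT LAWS BY PRODUCT HAAR from the height-zero clause**: a `K`-uniform a.e. bound `Z_K⁻¹·heightDensity ≤ C` (the
`n = 0` clause of `HeightwiseUpperBound`) gives `unitLaw_K ≤ C · π₀` setwise for every `K` (`γ ≥ 0`; tree `map_descendTo_restrict_eq_withDensity` +
`D_{0,K} = A_K` + monotonicity of `withDensity`). [cite: Balaban1985UV3, (5)-(6) pp.256-257] -/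
theorem unitLaw_le_smul_of_heightZeroBound (hγ : 0 ≤ γ) {C : ℝ}
    (h : ∀ (K : ℕ) (hK : 0 ≤ K), ∀ᵐ V ∂(fieldMeasure (F.P 0) 0 (Matrix.specialUnitaryGroup (Fin 2) ℂ)),
      (partitionFn (G := Matrix.specialUnitaryGroup (Fin 2) ℂ) (F.P K) ((F.scheme ℰp γ).β K))⁻¹ *
        heightDensity F γ hK Set.univ V ≤ C) (K : ℕ) :
    F.unitLaw ℰp measurableE_ℰp γ K ≤ ENNReal.ofReal C • fieldMeasure (F.P 0) 0 (Matrix.specialUnitaryGroup (Fin 2) ℂ) := by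
  have hmap := map_descendTo_restrict_eq_withDensity F (Nat.zero_le K) (S := Set.univ) MeasurableSet.univ hγ
  rw [Measure.restrict_univ, funext (descendTo_zero_eq_unitA F K)] at hmap
  rw [unitLaw_eq_map_unitA]
  show Measure.map (unitA F ℰp K) (gibbsK F ℰp γ K) ≤ _
  rw [hmap, ← withDensity_const]
  refine withDensity_mono ?_
  filter_upwards [h K (Nat.zero_le K)] with V hV
  exact ENNReal.ofReal_le_ofReal hV

/-- **THE HEIGHT-ZERO CLAUSE OF `HeightwiseUpperBound` GIVES THE UNIFORM-INTEGRABILITY CLAUSE OF `UnitDensityUI` AT `(F, γ)`** (`γ ≥ 0`): a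
`K`-uniform a.e. bound `Z_K⁻¹ρ̂_K ≤ C` makes `((∫ρ̂_K)⁻¹ρ̂_K − M)₊` vanish a.e. for `M ≥ C` (and `(∫ρ̂_K)⁻¹ = Z_K⁻¹`). [cite: Balaban1985UV3, (5) p.256, (6) p.257] -/
theorem ui_of_heightZeroBound (hγ : 0 ≤ γ)
    (h : ∃ C : ℝ, ∀ (K : ℕ) (hK : 0 ≤ K), ∀ᵐ V ∂(fieldMeasure (F.P 0) 0 (Matrix.specialUnitaryGroup (Fin 2) ℂ)),
      (partitionFn (G := Matrix.specialUnitaryGroup (Fin 2) ℂ) (F.P K) ((F.scheme ℰp γ).β K))⁻¹ *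
        heightDensity F γ hK Set.univ V ≤ C) :
    ∀ ε : ℝ, 0 < ε → ∃ (M : ℝ) (K₀ : ℕ), ∀ K : ℕ, K₀ ≤ K →
      ∫ V, max (((∫ W, unitDensity F γ K W ∂fieldMeasure (F.P 0) 0 (Matrix.specialUnitaryGroup (Fin 2) ℂ))⁻¹ *
          unitDensity F γ K V) - M) 0 ∂fieldMeasure (F.P 0) 0 (Matrix.specialUnitaryGroup (Fin 2) ℂ) ≤ ε := by
  obtain ⟨C, hC⟩ := h
  intro ε hε
  refine ⟨C, 0, fun K _ => ?_⟩
  have hZ := integral_unitDensity F hγ K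
  have hae : (fun V => max (((∫ W, unitDensity F γ K W ∂fieldMeasure (F.P 0) 0 (Matrix.specialUnitaryGroup (Fin 2) ℂ))⁻¹ *
      unitDensity F γ K V) - C) 0) =ᵐ[fieldMeasure (F.P 0) 0 (Matrix.specialUnitaryGroup (Fin 2) ℂ)] fun _ => (0 : ℝ) := by
    filter_upwards [hC K (Nat.zero_le K), heightDensity_zero_ae_eq_unitDensity F hγ K] with V hV hVeq
    rw [hZ]
    have : (partitionFn (G := Matrix.specialUnitaryGroup (Fin 2) ℂ) (F.P K) ((F.scheme ℰp γ).β K))⁻¹ * unitDensity F γ K V ≤ C := by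
      rw [← hVeq]; exact hV
    exact max_eq_right (by linarith)
  rw [integral_congr_ae hae, integral_zero]
  exact hε.le

/-- **`UnitDensityUI` (crux r3 of route SpecificationCompactness, stmt-QuantumFields-28251) ⇐ the heightwise upper stability schema with a
coupling threshold** — only its height-zero clause is used. [cite: Balaban1985UV3, Thm 1 p.257, (5)-(6) pp.256-257] -/
theorem unitDensityUI_of_heightwiseUpperBound
    (h : ∃ γ₁ : ℝ, 0 < γ₁ ∧ ∀ (F : T3Family) (γ : ℝ), 0 < γ → γ ≤ γ₁ → HeightwiseUpperBound F γ) :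
    Summit.QuantumFields.YangMills.Theses.SpecificationCompactness.UnitDensityUI := by
  obtain ⟨γ₁, hγ₁, hH⟩ := h
  refine ⟨γ₁, hγ₁, fun F γ hγ hle => ?_⟩
  exact ui_of_heightZeroBound F hγ.le ((hH F γ hγ hle) 0)

end Summit.QuantumFields.YangMills.Theorems.SpecificationCompactnessKernel

end
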